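import Summits.PneNP.PneNP.Theorems.BruckRyserSosSosBlindPlanesFunctionalIds
import Summits.PneNP.PneNP.Theorems.BruckRyserSosSosBlindPlanesTransfer
import Summits.PneNP.PneNP.Theses.BruckRyserSos

/-!
# PneNP / BruckRyserSos — `SosBlindPlanes`: fixed-degree SOS is blind to the non-existence of projective planes

Route `PneNP/BruckRyserSos`, crux stmt-PneNP-16761 (`SosBlindPlanes`), closing file.

**Theorem** (`sosBlindPlanes_allOrders`, `sosBlindPlanes_proof`). For every degree `d` there is
`N` such that for EVERY order `n ≥ N` the design system of the putative projective plane of order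
`n` (indeterminates `x_(p,B) = X (p v + B)`, `v = n² + n + 1`; row and column sums `n + 1`, row and
column inner products `1`, Booleanity) admits a degree-`d` pseudoexpectation
(Kothari–Mori–O'Donnell–Witmer Defs. 2.7–2.8). In particular this holds at the Bruck–Ryser–Chowla
excluded orders `n ≡ 1, 2 (mod 4)`, `n` not a sum of two squares, where no plane exists: degree-`d`
Sum-of-Squares (hence Sherali–Adams) does not refute `¬PP(n)` — the route's crux K1, with the
arithmetic hypotheses not even used.

Proof (files `…Relabel` … `…Transfer`). A degree-`d` pseudoexpectation invariant under the board
symmetry group `S_v × S_v` is a TABLE of finitely many numbers indexed by templates, independently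
of `v`; the identities become finitely many linear equations with coefficients polynomial in `n`,
and — the one non-formal point — positive semidefiniteness of the growing moment matrix `M` is
equivalent to the finitely many polynomial inequalities `tr (M q(M)²) ≥ 0`, `deg q < K₁`, because
`M` commutes with the symmetry group and therefore has at most `K₁` distinct eigenvalues
(`K₁` = number of template pairs), the traces being template sums, i.e. polynomials in `n`. So
"degree-`d` SOS does not refute order `x`" contains a SEMIALGEBRAIC set of reals `x` which contains
every prime (the genuine expectation over relabelings of `PG(2,p)`); a semialgebraic subset of the
line containing infinitely many primes contains every large real (Tarski–Seidenberg, the tree's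
`tarski_seidenberg_real_holds`).

References: P. Kothari, R. Mori, R. O'Donnell, D. Witmer, STOC 2017, Defs. 2.7–2.8;
R. H. Bruck, H. J. Ryser, Canad. J. Math. 1 (1949); J. Bochnak, M. Coste, M.-F. Roy, *Real
Algebraic Geometry* (1998), Thm. 2.2.1; M. Laurent, Math. Oper. Res. 28 (2003) (symmetry in
moment relaxations).
-/

set_option linter.dupNamespace false -- `Summit.PneNP.PneNP.…`: summit = sub-problem name (D-0017 single-conjunct layout)

noncomputable section

namespace Summit.PneNP.PneNP.Theorems.SosBlindPlanes

open Finset Function MvPolynomial Matrix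
open Literature.Computability.MetaComplexity

variable {v d : ℕ}

/-! ### Lower bounds for the total degree of the identity polynomials -/

/-- A sum of distinct monic monomials minus a constant has total degree at least the degree of any
of the monomials. [folklore] -/
theorem le_totalDegree_sum_monomial_sub_C {ι : Type*} [Fintype ι] (e : ι → (ℕ →₀ ℕ))
    (he : Function.Injective e) (i₀ : ι) (h0 : e i₀ ≠ 0) (r : ℝ) :
    ((e i₀).sum fun _ k => k) ≤ ((∑ i, monomial (e i) (1 : ℝ)) - C r).totalDegree := by
  classical
  apply le_totalDegree
  rw [mem_support_iff, coeff_sub, coeff_sum, coeff_C, if_neg (Ne.symm h0), sub_zero]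
  simp only [coeff_monomial, he.eq_iff]
  rw [Finset.sum_ite_eq' univ i₀ fun _ => (1 : ℝ)]
  simp

/-- `1 ≤ deg (Σ_B x_(p,B) - r)`. [folklore] -/
theorem one_le_totalDegree_rowLin (p : Fin v) (r : ℝ) :
    1 ≤ ((∑ B : Fin v, X (cellIx (p, B))) - C r : MvPolynomial ℕ ℝ).totalDegree := by
  have hB : 0 < v := p.pos
  let e : Fin v → (ℕ →₀ ℕ) := fun B => Finsupp.single (cellIx (p, B)) 1
  have he : Function.Injective e := fun B B' h =>
    (Prod.ext_iff.1 (cellIx_inj (Finsupp.single_left_injective one_ne_zero h))).2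
  have h := le_totalDegree_sum_monomial_sub_C e he ⟨0, hB⟩ (by simp [e]) r
  have hX : (∑ B : Fin v, X (cellIx (p, B)) : MvPolynomial ℕ ℝ) = ∑ B, monomial (e B) (1 : ℝ) := rfl
  rw [hX]
  simpa [e] using h

/-- `1 ≤ deg (Σ_p x_(p,B) - r)`. [folklore] -/
theorem one_le_totalDegree_colLin (B : Fin v) (r : ℝ) :
    1 ≤ ((∑ p : Fin v, X (cellIx (p, B))) - C r : MvPolynomial ℕ ℝ).totalDegree := by
  have hB : 0 < v := B.pos
  let e : Fin v → (ℕ →₀ ℕ) := fun p => Finsupp.single (cellIx (p, B)) 1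
  have he : Function.Injective e := fun p p' h =>
    (Prod.ext_iff.1 (cellIx_inj (Finsupp.single_left_injective one_ne_zero h))).1
  have h := le_totalDegree_sum_monomial_sub_C e he ⟨0, hB⟩ (by simp [e]) r
  have hX : (∑ p : Fin v, X (cellIx (p, B)) : MvPolynomial ℕ ℝ) = ∑ p, monomial (e p) (1 : ℝ) := rfl
  rw [hX]
  simpa [e] using h

/-- Products of two indeterminates as monomials. [folklore] -/
theorem X_mul_X_eq_monomial (a b : ℕ) :
    (X a * X b : MvPolynomial ℕ ℝ) = monomial (Finsupp.single a 1 + Finsupp.single b 1) 1 := by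
  rw [X, X, monomial_mul, mul_one]

/-- The degree of a product of two indeterminates. [folklore] -/
theorem sum_single_add_single (a b : ℕ) :
    ((Finsupp.single a 1 + Finsupp.single b 1 : ℕ →₀ ℕ).sum fun _ k => k) = 2 := by
  rw [Finsupp.sum_add_index' (fun _ => rfl) (fun _ _ _ => rfl), Finsupp.sum_single_index rfl,
    Finsupp.sum_single_index rfl]

/-- `2 ≤ deg (Σ_B x_(p,B) x_(p',B) - r)` for `p ≠ p'`. [folklore] -/
theorem two_le_totalDegree_rowQuad {p p' : Fin v} (hpp' : p ≠ p') (r : ℝ) :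
    2 ≤ ((∑ B : Fin v, X (cellIx (p, B)) * X (cellIx (p', B))) - C r : MvPolynomial ℕ ℝ).totalDegree := by
  have hB : 0 < v := p.pos
  let e : Fin v → (ℕ →₀ ℕ) := fun B =>
    Finsupp.single (cellIx (p, B)) 1 + Finsupp.single (cellIx (p', B)) 1
  have he : Function.Injective e := by
    intro B B' h
    by_contra hne
    have h1 := congrArg (fun f : ℕ →₀ ℕ => f (cellIx (p, B))) h
    have n1 : (p', B) ≠ (p, B) := fun h' => hpp' (Prod.ext_iff.1 h').1.symm
    have n2 : (p, B') ≠ (p, B) := fun h' => hne (Prod.ext_iff.1 h').2.symm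
    have n3 : (p', B') ≠ (p, B) := fun h' => hpp' (Prod.ext_iff.1 h').1.symm
    simp [e, cellIx_inj.eq_iff, n1, n2, n3] at h1
  have h0 : e ⟨0, hB⟩ ≠ 0 := by
    intro h0
    have := congrArg (fun f : ℕ →₀ ℕ => f (cellIx (p, ⟨0, hB⟩))) h0
    have n1 : (p', (⟨0, hB⟩ : Fin v)) ≠ (p, ⟨0, hB⟩) := fun h' => hpp' (Prod.ext_iff.1 h').1.symm
    simp [e, cellIx_inj.eq_iff, n1] at this
  have h := le_totalDegree_sum_monomial_sub_C e he ⟨0, hB⟩ h0 r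
  rw [sum_single_add_single] at h
  have hX : (∑ B : Fin v, X (cellIx (p, B)) * X (cellIx (p', B)) : MvPolynomial ℕ ℝ) =
      ∑ B, monomial (e B) (1 : ℝ) := by
    simp only [e, X_mul_X_eq_monomial]
  rw [hX]
  exact h

/-- `2 ≤ deg (Σ_p x_(p,B) x_(p,B') - r)` for `B ≠ B'`. [folklore] -/
theorem two_le_totalDegree_colQuad {B B' : Fin v} (hBB' : B ≠ B') (r : ℝ) :
    2 ≤ ((∑ p : Fin v, X (cellIx (p, B)) * X (cellIx (p, B'))) - C r : MvPolynomial ℕ ℝ).totalDegree := by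
  have hv : 0 < v := B.pos
  let e : Fin v → (ℕ →₀ ℕ) := fun p =>
    Finsupp.single (cellIx (p, B)) 1 + Finsupp.single (cellIx (p, B')) 1
  have he : Function.Injective e := by
    intro p p' h
    by_contra hne
    have h1 := congrArg (fun f : ℕ →₀ ℕ => f (cellIx (p, B))) h
    have n1 : (p, B') ≠ (p, B) := fun h' => hBB' (Prod.ext_iff.1 h').2.symm
    have n2 : (p', B) ≠ (p, B) := fun h' => hne (Prod.ext_iff.1 h').1.symm
    have n3 : (p', B') ≠ (p, B) := fun h' => hne (Prod.ext_iff.1 h').1.symm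
    simp [e, cellIx_inj.eq_iff, n1, n2, n3] at h1
  have h0 : e ⟨0, hv⟩ ≠ 0 := by
    intro h0
    have := congrArg (fun f : ℕ →₀ ℕ => f (cellIx (⟨0, hv⟩, B))) h0
    have n1 : ((⟨0, hv⟩ : Fin v), B') ≠ (⟨0, hv⟩, B) := fun h' => hBB' (Prod.ext_iff.1 h').2.symm
    simp [e, cellIx_inj.eq_iff, n1] at this
  have h := le_totalDegree_sum_monomial_sub_C e he ⟨0, hv⟩ h0 r
  rw [sum_single_add_single] at h
  have hX : (∑ p : Fin v, X (cellIx (p, B)) * X (cellIx (p, B')) : MvPolynomial ℕ ℝ) =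
      ∑ p, monomial (e p) (1 : ℝ) := by
    simp only [e, X_mul_X_eq_monomial]
  rw [hX]
  exact h

/-! ### From a good point to a pseudoexpectation -/

section Build

variable {n : ℕ} {μ : Tmpl d → ℝ}

/-- The identity bookkeeping: if `k ≤ deg q` and `E (q X^m) = 0` whenever `m` has at most
`d - k` cells, then `E` satisfies the identity `q = 0` in degree `d`. [folklore] -/
theorem satisfiesIdentity_of_monomials (μ : Tmpl d → ℝ) {q : MvPolynomial ℕ ℝ} {k : ℕ}
    (hq : k ≤ q.totalDegree)
    (hE : ∀ m : ℕ →₀ ℕ, (cellsOf v m).card ≤ d - k → Efun v (d + 1) μ (q * monomial m 1) = 0) :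
    SatisfiesIdentity d (Efun v (d + 1) μ) q := by
  intro r hr
  refine Efun_mul_eq_zero_of_monomial μ q r fun m hm => hE m ?_
  have := card_cellsOf_le_of_mem_support (v := v) (le_refl r.totalDegree) hm
  omega

variable (hgood : GoodPt d (n : ℝ) μ) (hDv : d + 1 ≤ n ^ 2 + n + 1)
include hgood hDv

/-- Template moments of a good table restricted to embedded templates are the table. [folklore] -/
theorem tmom_emb_eq : (fun W : Tmpl d =>
    tmom (d + 1) μ (rel (emb hDv) (emb hDv) W) : Tmpl d → ℝ) = μ := by
  funext W
  exact tmom_rel_template hgood.1 (Nat.succ_pos d) W (emb_injective hDv).injOn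
    (emb_injective hDv).injOn

omit hDv in
/-- Template moments of a good table are board-invariant. [folklore] -/
theorem boardInv_tmom : BoardInv (tmom (v := n ^ 2 + n + 1) (d + 1) μ) :=
  fun σ τ U => tmom_rel_perm hgood.1 (Nat.succ_pos d) σ τ U

/-- The board row-sum identity for a good table. [folklore] -/
theorem sum_tmom_addLine_one (U : Finset (Fin (n ^ 2 + n + 1) × Fin (n ^ 2 + n + 1)))
    (hU : U.card ≤ d - 1) (p : Fin (n ^ 2 + n + 1)) :
    ∑ B, tmom (d + 1) μ (addLine U {p} B) = ((n : ℝ) + 1) * tmom (d + 1) μ U := by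
  have hrow := hgood.2.2.1
  rw [Vr_natCast, show rcoef 1 (n : ℝ) = (n : ℝ) + 1 by simp [rcoef],
    ← tmom_emb_eq hgood hDv] at hrow
  exact sum_addLine_eq_of_rowIdentity (boardInv_tmom hgood) (Nat.succ_pos d) hDv one_pos
    (by omega) hrow U {p} hU (card_singleton p)

/-- The board row inner-product identity for a good table. [folklore] -/
theorem sum_tmom_addLine_two (hd : 2 ≤ d) (U : Finset (Fin (n ^ 2 + n + 1) × Fin (n ^ 2 + n + 1)))
    (hU : U.card ≤ d - 2) {p p' : Fin (n ^ 2 + n + 1)} (hpp' : p ≠ p') :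
    ∑ B, tmom (d + 1) μ (addLine U {p, p'} B) = 1 * tmom (d + 1) μ U := by
  have hrow := hgood.2.2.2.1
  rw [Vr_natCast, show rcoef 2 (n : ℝ) = 1 by simp [rcoef], ← tmom_emb_eq hgood hDv] at hrow
  exact sum_addLine_eq_of_rowIdentity (boardInv_tmom hgood) (Nat.succ_pos d) hDv two_pos
    (by omega) hrow U {p, p'} hU (card_pair hpp')

/-- The board column-sum identity for a good table. [folklore] -/
theorem sum_tmom_addCol_one (U : Finset (Fin (n ^ 2 + n + 1) × Fin (n ^ 2 + n + 1)))
    (hU : U.card ≤ d - 1) (B : Fin (n ^ 2 + n + 1)) :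
    ∑ p, tmom (d + 1) μ (addCol U {B} p) = ((n : ℝ) + 1) * tmom (d + 1) μ U := by
  have hrow := hgood.2.2.2.2.1
  rw [Vr_natCast, show rcoef 1 (n : ℝ) = (n : ℝ) + 1 by simp [rcoef]] at hrow
  have hrow' : RowIdentity (d + 1) ((n ^ 2 + n + 1 : ℕ) : ℝ) (d - 1) 1 ((n : ℝ) + 1)
      fun W => tmom (d + 1) μ (rel (emb hDv) (emb hDv) (swapC W)) := by
    have h := tmom_emb_eq hgood hDv
    intro τ₀ A₀ Bs h1 h2 h3
    have := hrow τ₀ A₀ Bs h1 h2 h3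
    simpa only [show ∀ W : Tmpl d, tmom (d + 1) μ (rel (emb hDv) (emb hDv) (swapC W)) = μ (swapC W)
      from fun W => congrFun h (swapC W)] using this
  exact sum_addCol_eq_of_rowIdentity (boardInv_tmom hgood) (Nat.succ_pos d) hDv one_pos
    (by omega) hrow' U {B} hU (card_singleton B)

/-- The board column inner-product identity for a good table. [folklore] -/
theorem sum_tmom_addCol_two (hd : 2 ≤ d) (U : Finset (Fin (n ^ 2 + n + 1) × Fin (n ^ 2 + n + 1)))
    (hU : U.card ≤ d - 2) {B B' : Fin (n ^ 2 + n + 1)} (hBB' : B ≠ B') :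
    ∑ p, tmom (d + 1) μ (addCol U {B, B'} p) = 1 * tmom (d + 1) μ U := by
  have hrow := hgood.2.2.2.2.2.1
  rw [Vr_natCast, show rcoef 2 (n : ℝ) = 1 by simp [rcoef]] at hrow
  have hrow' : RowIdentity (d + 1) ((n ^ 2 + n + 1 : ℕ) : ℝ) (d - 2) 2 1
      fun W => tmom (d + 1) μ (rel (emb hDv) (emb hDv) (swapC W)) := by
    have h := tmom_emb_eq hgood hDv
    intro τ₀ A₀ Bs h1 h2 h3
    have := hrow τ₀ A₀ Bs h1 h2 h3
    simpa only [show ∀ W : Tmpl d, tmom (d + 1) μ (rel (emb hDv) (emb hDv) (swapC W)) = μ (swapC W)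
      from fun W => congrFun h (swapC W)] using this
  exact sum_addCol_eq_of_rowIdentity (boardInv_tmom hgood) (Nat.succ_pos d) hDv two_pos
    (by omega) hrow' U {B, B'} hU (card_pair hBB')

/-- **The functional of a good table is a degree-`d` pseudoexpectation.** [KMOW 2017, Def. 2.7]
[folklore] -/
theorem isPseudoexpectation_Efun (hNv : Nsos d ≤ n ^ 2 + n + 1) :
    IsPseudoexpectation d (Efun (n ^ 2 + n + 1) (d + 1) μ) := by
  refine ⟨by rw [Efun_one μ (Nat.succ_pos d)]; exact hgood.2.1, fun p hp => ?_⟩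
  have hM := momMatrix_posSemidef_of_goodPt hgood hNv hDv (Vr_natCast n)
  refine Efun_mul_self_nonneg μ hM p fun m hm => ?_
  refine card_cellsOf_le_of_mem_support ?_ hm
  exact (Nat.le_div_iff_mul_le two_pos).2 (by omega)

/-- Row-sum identities. [KMOW 2017, Def. 2.8] [folklore] -/
theorem satisfiesIdentity_rowLin (p : Fin (n ^ 2 + n + 1)) :
    SatisfiesIdentity d (Efun (n ^ 2 + n + 1) (d + 1) μ)
      ((∑ B : Fin (n ^ 2 + n + 1), X (cellIx (p, B))) - C ((n : ℝ) + 1)) := by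
  refine satisfiesIdentity_of_monomials μ (one_le_totalDegree_rowLin p _) fun m hm => ?_
  rw [Efun_rowLin_mul]
  split_ifs with hg
  · rw [sum_tmom_addLine_one hgood hDv _ hm p, sub_self]
  · rfl

/-- Row inner-product identities. [KMOW 2017, Def. 2.8] [folklore] -/
theorem satisfiesIdentity_rowQuad {p p' : Fin (n ^ 2 + n + 1)} (hpp' : p ≠ p') :
    SatisfiesIdentity d (Efun (n ^ 2 + n + 1) (d + 1) μ)
      ((∑ B : Fin (n ^ 2 + n + 1), X (cellIx (p, B)) * X (cellIx (p', B))) - C (1 : ℝ)) := by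
  by_cases hd : 2 ≤ d
  · refine satisfiesIdentity_of_monomials μ (two_le_totalDegree_rowQuad hpp' _) fun m hm => ?_
    rw [Efun_rowQuad_mul]
    split_ifs with hg
    · rw [sum_tmom_addLine_two hgood hDv hd _ hm hpp', sub_self]
    · rfl
  · intro r hr
    exfalso
    have := two_le_totalDegree_rowQuad hpp' (1 : ℝ)
    omega

/-- Column-sum identities. [KMOW 2017, Def. 2.8] [folklore] -/
theorem satisfiesIdentity_colLin (B : Fin (n ^ 2 + n + 1)) :
    SatisfiesIdentity d (Efun (n ^ 2 + n + 1) (d + 1) μ)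
      ((∑ p : Fin (n ^ 2 + n + 1), X (cellIx (p, B))) - C ((n : ℝ) + 1)) := by
  refine satisfiesIdentity_of_monomials μ (one_le_totalDegree_colLin B _) fun m hm => ?_
  rw [Efun_colLin_mul]
  split_ifs with hg
  · rw [sum_tmom_addCol_one hgood hDv _ hm B, sub_self]
  · rfl

/-- Column inner-product identities. [KMOW 2017, Def. 2.8] [folklore] -/
theorem satisfiesIdentity_colQuad {B B' : Fin (n ^ 2 + n + 1)} (hBB' : B ≠ B') :
    SatisfiesIdentity d (Efun (n ^ 2 + n + 1) (d + 1) μ)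
      ((∑ p : Fin (n ^ 2 + n + 1), X (cellIx (p, B)) * X (cellIx (p, B'))) - C (1 : ℝ)) := by
  by_cases hd : 2 ≤ d
  · refine satisfiesIdentity_of_monomials μ (two_le_totalDegree_colQuad hBB' _) fun m hm => ?_
    rw [Efun_colQuad_mul]
    split_ifs with hg
    · rw [sum_tmom_addCol_two hgood hDv hd _ hm hBB', sub_self]
    · rfl
  · intro r hr
    exfalso
    have := two_le_totalDegree_colQuad hBB' (1 : ℝ)
    omega

end Build

/-! ### The theorem -/

/-- **Fixed-degree SOS is blind to the (non-)existence of projective planes of every large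
order**: the route's `SosBlindPlanes` WITHOUT the Bruck–Ryser hypotheses. [folklore] -/
theorem sosBlindPlanes_allOrders (d : ℕ) : ∃ N : ℕ, ∀ n ≥ N,
    ∃ E : MvPolynomial ℕ ℝ →ₗ[ℝ] ℝ, IsPseudoexpectation d E ∧
      (∀ w : ℕ, SatisfiesIdentity d E (boolAxiom w)) ∧
      (∀ p < n ^ 2 + n + 1, SatisfiesIdentity d E
        ((∑ B ∈ Finset.range (n ^ 2 + n + 1), MvPolynomial.X (p * (n ^ 2 + n + 1) + B)) -
          MvPolynomial.C ((n + 1 : ℕ) : ℝ))) ∧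
      (∀ B < n ^ 2 + n + 1, SatisfiesIdentity d E
        ((∑ p ∈ Finset.range (n ^ 2 + n + 1), MvPolynomial.X (p * (n ^ 2 + n + 1) + B)) -
          MvPolynomial.C ((n + 1 : ℕ) : ℝ))) ∧
      (∀ p < n ^ 2 + n + 1, ∀ p' < n ^ 2 + n + 1, p ≠ p' → SatisfiesIdentity d E
        ((∑ B ∈ Finset.range (n ^ 2 + n + 1), MvPolynomial.X (p * (n ^ 2 + n + 1) + B) *
          MvPolynomial.X (p' * (n ^ 2 + n + 1) + B)) - MvPolynomial.C (1 : ℝ))) ∧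
      (∀ B < n ^ 2 + n + 1, ∀ B' < n ^ 2 + n + 1, B ≠ B' → SatisfiesIdentity d E
        ((∑ p ∈ Finset.range (n ^ 2 + n + 1), MvPolynomial.X (p * (n ^ 2 + n + 1) + B) *
          MvPolynomial.X (p * (n ^ 2 + n + 1) + B')) - MvPolynomial.C (1 : ℝ))) := by
  obtain ⟨N₀, hN₀⟩ := exists_goodPt_of_large d
  refine ⟨max N₀ (Nsos d + (d + 1)), fun n hn => ?_⟩
  obtain ⟨μ, hgood⟩ := hN₀ n (le_of_max_le_left hn)
  have hn' : Nsos d + (d + 1) ≤ n := le_of_max_le_right hn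
  have hv : n ≤ n ^ 2 + n + 1 := by nlinarith
  have hNv : Nsos d ≤ n ^ 2 + n + 1 := by omega
  have hDv : d + 1 ≤ n ^ 2 + n + 1 := by omega
  set v := n ^ 2 + n + 1 with hvdef
  refine ⟨Efun v (d + 1) μ, isPseudoexpectation_Efun hgood hDv hNv,
    fun w => fun r _ => Efun_boolAxiom_mul μ w r, ?_, ?_, ?_, ?_⟩
  · intro p hp
    have h := satisfiesIdentity_rowLin hgood hDv ⟨p, hp⟩
    rw [Finset.sum_range fun B => MvPolynomial.X (p * v + B)]
    push_cast
    exact h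
  · intro B hB
    have h := satisfiesIdentity_colLin hgood hDv ⟨B, hB⟩
    rw [Finset.sum_range fun p => MvPolynomial.X (p * v + B)]
    push_cast
    exact h
  · intro p hp p' hp' hpp'
    have h := satisfiesIdentity_rowQuad hgood hDv (p := ⟨p, hp⟩) (p' := ⟨p', hp'⟩)
      (fun h => hpp' (congrArg Fin.val h))
    rw [Finset.sum_range fun B => MvPolynomial.X (p * v + B) * MvPolynomial.X (p' * v + B)]
    exact h
  · intro B hB B' hB' hBB'
    have h := satisfiesIdentity_colQuad hgood hDv (B := ⟨B, hB⟩) (B' := ⟨B', hB'⟩)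
      (fun h => hBB' (congrArg Fin.val h))
    rw [Finset.sum_range fun p => MvPolynomial.X (p * v + B) * MvPolynomial.X (p * v + B')]
    exact h

/-- **The crux `SosBlindPlanes` of route `PneNP/BruckRyserSos`** (stmt-PneNP-16761): for every
degree `d`, for all sufficiently large Bruck–Ryser–Chowla excluded orders `n`, degree-`d` SOS does
not refute the existence of a projective plane of order `n`. [folklore] -/
theorem sosBlindPlanes_proof : Summit.PneNP.PneNP.Theses.BruckRyserSos.SosBlindPlanes := by
  intro d
  obtain ⟨N, hN⟩ := sosBlindPlanes_allOrders d
  exact ⟨N, fun n hn _ _ => hN n hn⟩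

end Summit.PneNP.PneNP.Theorems.SosBlindPlanes
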